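import Mathlib
import Summits.Ventures.HodgeRepro2.T5CompletionDegree
import Summits.Ventures.HodgeRepro2.T5EisensteinField
import Summits.Ventures.HodgeRepro2.T5WildConductor

/-!
# A CONCRETE TAME RAMIFIED PLACE: `ℚ(ζ₃)/ℚ` at `3` — the hypotheses of the ramified chain hold, `2` is a unit,
and `f(η_v) = 1` (T5EisensteinPlace)

The tame twin of T5GaussianPlace. `K = ℚ`, `L₃ = ℚ(ζ₃) = ℚ(√−3)` (T5EisensteinField), `v = v₃` the place of `ℚ` at `3`,
`w` ANY place of `L₃` above `v₃` (one exists: `exists_liesOver`). On Mathlib's completions `K_v ⊆ L_w`: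
* `[L_w : K_v] = 2` (`finrank_eq_two`: T5CompletionDegree + `X² + X + 1` has no root in `ℚ₃`);
* `ϖ = 3` is a uniformiser of `O_{K_v}` (`irreducible_three`), `π = 1 − ω` is a uniformiser of `O_{L_w}`
  (`irreducible_pi`), and `3 = −ω² π²` is NOT irreducible in `O_{L_w}` (`not_irreducible_algebraMap_three`):
  the place is RAMIFIED, and TAME: `2` is a unit of `O_{K_v}` (`isUnit_two`);
* there is `σ ≠ 1` in `Gal(L_w/K_v)`, and every such `σ` sends `ω ↦ −1 − ω = ω²` (`algEquiv_omegaw`), so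
  `σ π − π = 2ω + 1 = √−3` has valuation `exp(−1)`;
* hence THE CONDUCTOR EXPONENT of the norm character `η_v` of `L_w/K_v` is `f(η_v) = 1` (`normCharConductor_eq_one`:
  row 176's `f(η_v) = v_E(σπ − π)`) — the tame value — and the route's (iv-a) produces a conjugate-symplectic
  character of conductor EXACTLY `2·0 + 1 = 1` (`exists_CS_conductor_eq_one`).
Together with T5GaussianPlace (wild, `f = 2`) this exhibits the hypothesis set of rows 169–177 (and of the tame-case
files with `IsUnit (2 : O_{K_v})`) on concrete pairs of number fields and places inside Mathlib, in both residue
characteristics the chain distinguishes.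

No axiom beyond the standard trio; nothing of the scored record changes.
§8(d): uses an L-value-free non-vanishing device: NO.
-/

namespace Summit.Ventures.HodgeRepro2.T5EisensteinPlace

open IsDedekindDomain HeightOneSpectrum NumberField
open Summit.Ventures.HodgeRepro2.T5EisensteinField

/-! ### The place `v₃` of `ℚ` and a place `w` of `ℚ(ζ₃)` above it -/

/-- `v₃.asIdeal = (3)` in `𝓞 ℚ`. -/
theorem asIdeal_v₃ : v₃.asIdeal = Ideal.span {(3 : NumberField.RingOfIntegers ℚ)} := by
  unfold v₃
  simp only [Rat.HeightOneSpectrum.primesEquiv, Equiv.coe_fn_symm_mk,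
    IsDedekindDomain.HeightOneSpectrum.ofPrime_asIdeal, Ideal.map_span, Set.image_singleton]
  congr 2
  exact map_ofNat _ 3

/-- `3 ≠ 0` in `𝓞 ℚ`. -/
theorem three_ne_zero' : (3 : NumberField.RingOfIntegers ℚ) ≠ 0 := by
  intro h
  have h' := congrArg (algebraMap (NumberField.RingOfIntegers ℚ) ℚ) h
  rw [map_ofNat, map_zero] at h'
  norm_num at h'

/-- `3 ∈ v₃`. -/
theorem three_mem_v₃ : (3 : NumberField.RingOfIntegers ℚ) ∈ v₃.asIdeal := by
  rw [asIdeal_v₃]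
  exact Ideal.mem_span_singleton_self 3

/-- `2 ∉ v₃` (`3 ∤ 2` in `𝓞 ℚ ≃ ℤ`). -/
theorem two_notMem_v₃ : (2 : NumberField.RingOfIntegers ℚ) ∉ v₃.asIdeal := by
  rw [asIdeal_v₃, Ideal.mem_span_singleton]
  intro h
  have h' := map_dvd Rat.ringOfIntegersEquiv h
  rw [map_ofNat, map_ofNat] at h'
  norm_num at h'

/-- Some place `w` of `ℚ(ζ₃)` lies over `v₃`. -/
theorem exists_liesOver : ∃ w : HeightOneSpectrum (NumberField.RingOfIntegers L₃), w.asIdeal.LiesOver v₃.asIdeal := by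
  haveI : v₃.asIdeal.IsMaximal := v₃.isMaximal
  obtain ⟨Q, hQmax, hQ⟩ := Ideal.exists_ideal_over_maximal_of_isIntegral
    (S := NumberField.RingOfIntegers L₃) v₃.asIdeal
    (by
      rw [(RingHom.injective_iff_ker_eq_bot (algebraMap (NumberField.RingOfIntegers ℚ)
        (NumberField.RingOfIntegers L₃))).mp (FaithfulSMul.algebraMap_injective _ _)]
      exact bot_le)
  haveI := hQmax
  refine ⟨⟨Q, hQmax.isPrime, ?_⟩, ⟨?_⟩⟩
  · rintro rfl
    rw [Ideal.comap_bot_of_injective _ (FaithfulSMul.algebraMap_injective _ _)] at hQ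
    exact v₃.ne_bot hQ.symm
  · exact hQ.symm

variable (w : HeightOneSpectrum (NumberField.RingOfIntegers L₃)) [w.asIdeal.LiesOver v₃.asIdeal]

/-- `3 ∈ w`. -/
theorem three_mem_w : (3 : NumberField.RingOfIntegers L₃) ∈ w.asIdeal := by
  have h : v₃.asIdeal ≤ Ideal.under (NumberField.RingOfIntegers ℚ) w.asIdeal :=
    (Ideal.LiesOver.over (P := w.asIdeal) (p := v₃.asIdeal)).le
  have h3 := h three_mem_v₃
  rw [Ideal.mem_comap, map_ofNat] at h3
  exact h3

/-- `1 − ω ∈ w` (its square `−3ω` is in `w`). -/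
theorem one_sub_omegaO_mem_w : 1 - ωO ∈ w.asIdeal := by
  apply w.isPrime.mem_of_pow_mem 2
  rw [one_sub_omegaO_sq]
  exact neg_mem (Ideal.mul_mem_right _ _ (three_mem_w w))

/-! ### `[L_w : K_v] = 2` -/

omit [w.asIdeal.LiesOver v₃.asIdeal] in
/-- The image of `ω` in `L_w` satisfies `x² + x + 1 = 0`. -/
theorem omega_completion_root :
    (algebraMap L₃ (w.adicCompletion L₃) ω) ^ 2 + algebraMap L₃ (w.adicCompletion L₃) ω + 1 = 0 := by
  rw [← map_one (algebraMap L₃ (w.adicCompletion L₃)), ← map_pow, ← map_add, ← map_add,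
    omega_sq_add_omega_add_one, map_zero]

/-- The image of `ω` is not in the image of `K_v`: `X² + X + 1` has no root in `K_v`. -/
theorem omega_notMem_range :
    algebraMap L₃ (w.adicCompletion L₃) ω ∉
      Set.range (algebraMap (v₃.adicCompletion ℚ) (w.adicCompletion L₃)) := by
  rintro ⟨y, hy⟩
  apply not_exists_root
  refine ⟨y, (algebraMap (v₃.adicCompletion ℚ) (w.adicCompletion L₃)).injective ?_⟩
  rw [map_add, map_add, map_pow, map_one, map_zero, hy]
  exact omega_completion_root w

/-- `[L_w : K_v] = 2`. -/
theorem finrank_eq_two :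
    Module.finrank (v₃.adicCompletion ℚ) (w.adicCompletion L₃) = 2 :=
  T5CompletionDegree.finrank_eq_two v₃ w T5EisensteinField.finrank_eq_two (omega_notMem_range w)

/-! ### The uniformisers `ϖ = 3` of `K_v` and `π = 1 − ω` of `L_w`; ramification; `2` is a unit -/

/-- `v(3) = exp(−1)` in `K_{v₃}`. -/
theorem val_three : Valued.v (3 : v₃.adicCompletion ℚ) = WithZero.exp (-1) := by
  have e := IsDedekindDomain.HeightOneSpectrum.valuedAdicCompletion_eq_valuation (K := ℚ) v₃
    (3 : NumberField.RingOfIntegers ℚ)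
  rw [IsDedekindDomain.HeightOneSpectrum.valuation_of_algebraMap,
    IsDedekindDomain.HeightOneSpectrum.intValuation_singleton v₃ three_ne_zero' asIdeal_v₃] at e
  simp only [Algebra.cast, map_ofNat] at e
  exact e

/-- `v(2) = 1` in `K_{v₃}`. -/
theorem val_two : Valued.v (2 : v₃.adicCompletion ℚ) = 1 := by
  have e := IsDedekindDomain.HeightOneSpectrum.valuedAdicCompletion_eq_valuation (K := ℚ) v₃
    (2 : NumberField.RingOfIntegers ℚ)
  rw [IsDedekindDomain.HeightOneSpectrum.valuation_of_algebraMap] at e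
  simp only [Algebra.cast, map_ofNat] at e
  rw [e]
  apply le_antisymm (IsDedekindDomain.HeightOneSpectrum.intValuation_le_one v₃ 2)
  rw [← not_lt, IsDedekindDomain.HeightOneSpectrum.intValuation_lt_one_iff_mem]
  exact two_notMem_v₃

/-- `ϖ = 3` is a uniformiser of `O_{K_{v₃}}`. -/
theorem irreducible_three : Irreducible (3 : v₃.adicCompletionIntegers ℚ) :=
  (Summit.Ventures.HodgeRepro2.T5AdicCompletionConductor.irreducible_iff_val_eq_exp_neg_one v₃
    (3 : v₃.adicCompletionIntegers ℚ)).mpr val_three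

/-- TAME: `2` is a unit of `O_{K_{v₃}}`. -/
theorem isUnit_two : IsUnit (2 : v₃.adicCompletionIntegers ℚ) :=
  IsDedekindDomain.HeightOneSpectrum.adicCompletionIntegers.isUnit_iff_valued_eq_one.mpr val_two

/-- The image of `1 − ω` in `O_{L_w}`. -/
noncomputable def π : w.adicCompletionIntegers L₃ :=
  algebraMap (NumberField.RingOfIntegers L₃) (w.adicCompletionIntegers L₃) (1 - ωO)

/-- The image of `ω` in `O_{L_w}`. -/
noncomputable def ωw : w.adicCompletionIntegers L₃ :=
  algebraMap (NumberField.RingOfIntegers L₃) (w.adicCompletionIntegers L₃) ωO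

omit [w.asIdeal.LiesOver v₃.asIdeal] in
/-- `ω_w · ω_w² = 1`: `ω_w` is a unit of `O_{L_w}`. -/
theorem omegaw_mul_omegaw_sq : ωw w * ωw w ^ 2 = 1 := by
  unfold ωw
  rw [← map_pow, ← map_mul, omegaO_mul_omegaO_sq, map_one]

omit [w.asIdeal.LiesOver v₃.asIdeal] in
/-- `IsUnit ω_w`. -/
theorem isUnit_omegaw : IsUnit (ωw w) :=
  isUnit_iff_exists_inv.mpr ⟨_, omegaw_mul_omegaw_sq w⟩

omit [w.asIdeal.LiesOver v₃.asIdeal] in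
/-- `IsUnit (−ω_w²)`. -/
theorem isUnit_neg_omegaw_sq : IsUnit (-(ωw w ^ 2)) :=
  (isUnit_omegaw w).pow 2 |>.neg

omit [w.asIdeal.LiesOver v₃.asIdeal] in
/-- `3 = (−ω_w²) · π²` in `O_{L_w}`. -/
theorem three_eq_neg_omegaw_sq_mul_pi_sq : (3 : w.adicCompletionIntegers L₃) = -(ωw w ^ 2) * π w ^ 2 := by
  unfold ωw π
  rw [← map_pow, ← map_pow, ← map_neg, ← map_mul, one_sub_omegaO_sq]
  have : -(ωO ^ 2) * -(3 * ωO) = 3 := by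
    calc -(ωO ^ 2) * -(3 * ωO) = 3 * (ωO * ωO ^ 2) := by ring
      _ = 3 := by rw [omegaO_mul_omegaO_sq, mul_one]
  rw [this, map_ofNat]

omit [w.asIdeal.LiesOver v₃.asIdeal] in
/-- The valuation of `π` in `L_w` is the `w`-adic valuation of `1 − ω`. -/
theorem val_pi : Valued.v (π w : w.adicCompletion L₃) = w.intValuation (1 - ωO) := by
  have h := IsDedekindDomain.HeightOneSpectrum.valuedAdicCompletion_eq_valuation (K := L₃) w (1 - ωO)
  rw [IsDedekindDomain.HeightOneSpectrum.valuation_of_algebraMap] at h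
  rw [← h]
  rfl

/-- `v(π) < 1`: `π` is not a unit of `O_{L_w}`. -/
theorem val_pi_lt_one : Valued.v (π w : w.adicCompletion L₃) < 1 := by
  rw [val_pi, IsDedekindDomain.HeightOneSpectrum.intValuation_lt_one_iff_mem]
  exact one_sub_omegaO_mem_w w

/-- `π` is not a unit of `O_{L_w}`. -/
theorem not_isUnit_pi : ¬ IsUnit (π w) := by
  intro h
  have := Summit.Ventures.HodgeRepro2.T5AdicCompletionHenselian.val_coe_units_eq_one w h.unit
  rw [IsUnit.unit_spec] at this
  exact absurd this (ne_of_lt (val_pi_lt_one w))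

/-- RAMIFICATION: `ϖ = 3` is not irreducible in `O_{L_w}` (`3 = (−ω_w² π) · π` with `π` a non-unit). -/
theorem not_irreducible_algebraMap_three :
    ¬ Irreducible (algebraMap (v₃.adicCompletionIntegers ℚ) (w.adicCompletionIntegers L₃)
      (3 : v₃.adicCompletionIntegers ℚ)) := by
  intro hirr
  rw [map_ofNat] at hirr
  have h3 : (3 : w.adicCompletionIntegers L₃) = (-(ωw w ^ 2) * π w) * π w := by
    rw [three_eq_neg_omegaw_sq_mul_pi_sq]
    ring
  rcases hirr.isUnit_or_isUnit h3 with h | h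
  · exact not_isUnit_pi w (isUnit_of_mul_isUnit_right h)
  · exact not_isUnit_pi w h

omit [w.asIdeal.LiesOver v₃.asIdeal] in
/-- `v(−ω_w²) = 1`. -/
theorem val_neg_omegaw_sq : Valued.v ((-(ωw w ^ 2) : w.adicCompletionIntegers L₃) : w.adicCompletion L₃) = 1 := by
  have := Summit.Ventures.HodgeRepro2.T5AdicCompletionHenselian.val_coe_units_eq_one w (isUnit_neg_omegaw_sq w).unit
  rwa [IsUnit.unit_spec] at this

/-- `v(3 : L_w) = exp(−1)²` (the ramified square law). -/
theorem val_three_completion : Valued.v (3 : w.adicCompletion L₃) = WithZero.exp (-1) ^ 2 := by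
  obtain ⟨π₀, hπ₀⟩ := Summit.Ventures.HodgeRepro2.T5LocalNormIndex.exists_irreducible_adicCompletionIntegers w
  have hsq := Summit.Ventures.HodgeRepro2.T5RamifiedNormTransfer.val_algebraMap_eq_sq v₃ w (finrank_eq_two w)
    irreducible_three hπ₀ (not_irreducible_algebraMap_three w) (3 : v₃.adicCompletion ℚ)
  rwa [map_ofNat, val_three] at hsq

/-- `v(π) = exp(−1)`: `v(π)² = v(3 : L_w) = v(3 : K_v)² = exp(−1)²`. -/
theorem val_pi_eq : Valued.v (π w : w.adicCompletion L₃) = WithZero.exp (-1) := by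
  have h3 : Valued.v ((3 : w.adicCompletionIntegers L₃) : w.adicCompletion L₃) =
      Valued.v (π w : w.adicCompletion L₃) ^ 2 := by
    rw [three_eq_neg_omegaw_sq_mul_pi_sq]
    push_cast
    rw [map_mul, map_pow]
    have := val_neg_omegaw_sq w
    push_cast at this
    rw [this, one_mul]
  have h3' : ((3 : w.adicCompletionIntegers L₃) : w.adicCompletion L₃) = 3 := rfl
  rw [h3', val_three_completion] at h3
  have hne : Valued.v (π w : w.adicCompletion L₃) ≠ 0 := by
    rw [Valuation.ne_zero_iff]
    intro h0
    have : (3 : w.adicCompletion L₃) = 0 := by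
      rw [← h3', three_eq_neg_omegaw_sq_mul_pi_sq]
      push_cast
      rw [h0]
      ring
    exact three_ne_zero this
  obtain ⟨k, hk⟩ : ∃ k : ℤ, Valued.v (π w : w.adicCompletion L₃) = WithZero.exp k :=
    ⟨_, (WithZero.exp_log hne).symm⟩
  rw [hk, ← WithZero.exp_nsmul, ← WithZero.exp_nsmul, WithZero.exp_inj] at h3
  rw [hk]
  congr 1
  simp only [nsmul_eq_mul] at h3
  omega

/-- `π = 1 − ω` is a uniformiser of `O_{L_w}`. -/
theorem irreducible_pi : Irreducible (π w) :=
  (Summit.Ventures.HodgeRepro2.T5AdicCompletionConductor.irreducible_iff_val_eq_exp_neg_one w (π w)).mpr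
    (val_pi_eq w)

/-! ### The Galois conjugation and `σ π − π = 2ω + 1` -/

/-- There is a non-trivial `K_v`-automorphism of `L_w`. -/
theorem exists_algEquiv_ne_one :
    ∃ σ : (w.adicCompletion L₃) ≃ₐ[v₃.adicCompletion ℚ] (w.adicCompletion L₃), σ ≠ 1 :=
  Summit.Ventures.HodgeRepro2.T5AdicCompletionConjugation.exists_algEquiv_ne_one v₃ w (finrank_eq_two w)

omit [w.asIdeal.LiesOver v₃.asIdeal] in
/-- `(π : L_w) = 1 − ω_w`. -/
theorem coe_pi : (π w : w.adicCompletion L₃) = 1 - (ωw w : w.adicCompletion L₃) := by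
  unfold π ωw
  rw [map_sub, map_one]
  push_cast
  rfl

omit [w.asIdeal.LiesOver v₃.asIdeal] in
/-- `ω_w² + ω_w + 1 = 0` in `L_w`. -/
theorem omegaw_sq_add_omegaw_add_one :
    (ωw w : w.adicCompletion L₃) ^ 2 + (ωw w : w.adicCompletion L₃) + 1 = 0 := by
  unfold ωw
  have : ((algebraMap (NumberField.RingOfIntegers L₃) (w.adicCompletionIntegers L₃) ωO : w.adicCompletionIntegers L₃) :
      w.adicCompletion L₃) = algebraMap L₃ (w.adicCompletion L₃) ω := rfl
  rw [this]
  exact omega_completion_root w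

/-- Every non-trivial `σ ∈ Gal(L_w/K_v)` sends `ω` to `−1 − ω` (`= ω²`, the other root of `X² + X + 1`). -/
theorem algEquiv_omegaw (σ : (w.adicCompletion L₃) ≃ₐ[v₃.adicCompletion ℚ] (w.adicCompletion L₃)) (hσ : σ ≠ 1) :
    σ (ωw w : w.adicCompletion L₃) = -1 - (ωw w : w.adicCompletion L₃) := by
  have h0 := omegaw_sq_add_omegaw_add_one w
  have hσ0 : (σ (ωw w : w.adicCompletion L₃)) ^ 2 + σ (ωw w : w.adicCompletion L₃) + 1 = 0 := by
    rw [← map_pow, ← map_one σ, ← map_add, ← map_add, h0, map_zero]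
  have hprod : (σ (ωw w : w.adicCompletion L₃) - (ωw w : w.adicCompletion L₃)) *
      (σ (ωw w : w.adicCompletion L₃) + (ωw w : w.adicCompletion L₃) + 1) = 0 := by
    linear_combination hσ0 - h0
  rcases mul_eq_zero.mp hprod with h | h
  · -- `σ` fixes `ω`, hence `π`, hence everything: `σ = 1`
    exfalso
    apply hσ
    have hfix : σ (ωw w : w.adicCompletion L₃) = (ωw w : w.adicCompletion L₃) := sub_eq_zero.mp h
    ext y
    obtain ⟨a, b, hy⟩ := Summit.Ventures.HodgeRepro2.T5RamifiedIntegralBasis.exists_eq_algebraMap_add_algebraMap_mul_uniformizer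
      v₃ w (finrank_eq_two w) irreducible_three (irreducible_pi w) (not_irreducible_algebraMap_three w) y
    rw [hy, map_add, map_mul, AlgEquiv.commutes, AlgEquiv.commutes, coe_pi, map_sub, map_one, hfix]
    rfl
  · linear_combination h

/-- `σ π − π = 2 ω_w + 1` for every non-trivial `σ`. -/
theorem algEquiv_pi_sub_pi (σ : (w.adicCompletion L₃) ≃ₐ[v₃.adicCompletion ℚ] (w.adicCompletion L₃)) (hσ : σ ≠ 1) :
    σ (π w : w.adicCompletion L₃) - (π w : w.adicCompletion L₃) = 2 * (ωw w : w.adicCompletion L₃) + 1 := by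
  rw [coe_pi, map_sub, map_one, algEquiv_omegaw w σ hσ]
  ring

omit [w.asIdeal.LiesOver v₃.asIdeal] in
/-- `(2 ω_w + 1)² = −3` in `L_w`. -/
theorem two_mul_omegaw_add_one_sq : (2 * (ωw w : w.adicCompletion L₃) + 1) ^ 2 = -3 := by
  linear_combination 4 * omegaw_sq_add_omegaw_add_one w

/-- `v(σ π − π) = exp(−1)`: the ramification break of `L_w/K_v` is `t = 0` (tame). -/
theorem val_algEquiv_pi_sub_pi (σ : (w.adicCompletion L₃) ≃ₐ[v₃.adicCompletion ℚ] (w.adicCompletion L₃))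
    (hσ : σ ≠ 1) :
    Valued.v (σ (π w : w.adicCompletion L₃) - (π w : w.adicCompletion L₃)) = WithZero.exp (-(1 : ℕ) : ℤ) := by
  rw [algEquiv_pi_sub_pi w σ hσ]
  have hsq : Valued.v (2 * (ωw w : w.adicCompletion L₃) + 1) ^ 2 = WithZero.exp (-1) ^ 2 := by
    rw [← map_pow, two_mul_omegaw_add_one_sq, Valuation.map_neg, val_three_completion]
  have hne : Valued.v (2 * (ωw w : w.adicCompletion L₃) + 1) ≠ 0 := by
    rw [Valuation.ne_zero_iff]
    intro h0
    have := two_mul_omegaw_add_one_sq w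
    rw [h0] at this
    norm_num at this
  obtain ⟨k, hk⟩ : ∃ k : ℤ, Valued.v (2 * (ωw w : w.adicCompletion L₃) + 1) = WithZero.exp k :=
    ⟨_, (WithZero.exp_log hne).symm⟩
  rw [hk, ← WithZero.exp_nsmul, ← WithZero.exp_nsmul, WithZero.exp_inj] at hsq
  rw [hk]
  congr 1
  simp only [nsmul_eq_mul] at hsq
  omega

/-! ### THE CONDUCTOR: `f(η_v) = 1` -/

/-- THE CONDUCTOR EXPONENT OF THE NORM CHARACTER OF `ℚ₃(√−3)/ℚ₃` IS `1` (tame): for every non-trivial `σ`,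
`normCharConductor v₃ w σ 3 hind = 1` (row 176's `f(η_v) = v_E(σπ − π)` with `v(σπ − π) = v(2ω + 1) = exp(−1)`). -/
theorem normCharConductor_eq_one (σ : (w.adicCompletion L₃) ≃ₐ[v₃.adicCompletion ℚ] (w.adicCompletion L₃))
    (hσ : σ ≠ 1) (hind : (Summit.Ventures.HodgeRepro2.T5AdicCompletionNormGroup.normGroup v₃ w σ).index = 2) :
    Summit.Ventures.HodgeRepro2.T5NormCharConductor.normCharConductor v₃ w σ
      (3 : v₃.adicCompletionIntegers ℚ) hind = 1 :=
  Summit.Ventures.HodgeRepro2.T5WildConductor.normCharConductor_eq_break v₃ w (finrank_eq_two w) irreducible_three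
    (irreducible_pi w) (not_irreducible_algebraMap_three w) σ hσ le_rfl (val_algEquiv_pi_sub_pi w σ hσ) hind

/-- The index hypothesis holds: `[K_v^× : N L_w^×] = 2`. -/
theorem index_normGroup_eq_two (σ : (w.adicCompletion L₃) ≃ₐ[v₃.adicCompletion ℚ] (w.adicCompletion L₃))
    (hσ : σ ≠ 1) : (Summit.Ventures.HodgeRepro2.T5AdicCompletionNormGroup.normGroup v₃ w σ).index = 2 :=
  Summit.Ventures.HodgeRepro2.T5LocalNormIndex.index_normGroup_eq_two v₃ w σ (finrank_eq_two w) hσ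

/-- THE ROUTE'S (iv-a) AT THE CONCRETE TAME PLACE: a conjugate-symplectic character `ω` of `L_w^×` restricting to `η_v`
on `F_v^×`, trivial on some `U_E^{(m)}`, of conductor EXACTLY `1 = 2·0 + 1`. -/
theorem exists_CS_conductor_eq_one (σ : (w.adicCompletion L₃) ≃ₐ[v₃.adicCompletion ℚ] (w.adicCompletion L₃))
    (hσ : σ ≠ 1) :
    ∃ χ : (w.adicCompletion L₃)ˣ →* ℂˣ,
      (∀ f : Summit.Ventures.HodgeRepro2.T6.N5LocalInertCompletion.Fsub v₃ w,
        χ f = Summit.Ventures.HodgeRepro2.T6.N5LocalInertCompletion.ηF v₃ w σ (index_normGroup_eq_two w σ hσ) f) ∧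
      (∃ m, Summit.Ventures.HodgeRepro2.T6.N5LocalRamCompletion.Uπ w (π w) m ≤ χ.ker) ∧
      Summit.Ventures.HodgeRepro2.T5ConductorArithmetic.conductor
        (Summit.Ventures.HodgeRepro2.T6.N5LocalRamCompletion.Uπ w (π w)) χ = 1 := by
  obtain ⟨χ, h1, h2, h3⟩ := Summit.Ventures.HodgeRepro2.T5RamifiedOddConductor.exists_CS_conductor_eq v₃ w
    (finrank_eq_two w) irreducible_three (irreducible_pi w) (not_irreducible_algebraMap_three w) σ hσ
    (index_normGroup_eq_two w σ hσ)
  refine ⟨χ, h1, h2, ?_⟩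
  rw [h3, normCharConductor_eq_one w σ hσ]

/-- THE HYPOTHESIS SET OF THE RAMIFIED CHAIN IS SATISFIABLE AT A TAME PLACE (README §10.5(ii)(c)/(d) witness): at
`ℚ(ζ₃)/ℚ` and any `w ∣ 3`, there are uniformisers `ϖ`, `π`, the place is ramified, `2` is a unit of `O_{K_v}`, and
`Gal(L_w/K_v)` has a non-trivial element. -/
theorem hypotheses_satisfiable :
    Module.finrank (v₃.adicCompletion ℚ) (w.adicCompletion L₃) = 2 ∧
    ∃ (ϖ : v₃.adicCompletionIntegers ℚ) (π' : w.adicCompletionIntegers L₃),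
      Irreducible ϖ ∧ Irreducible π' ∧
      ¬ Irreducible (algebraMap (v₃.adicCompletionIntegers ℚ) (w.adicCompletionIntegers L₃) ϖ) ∧
      IsUnit (2 : v₃.adicCompletionIntegers ℚ) ∧
      ∃ σ : (w.adicCompletion L₃) ≃ₐ[v₃.adicCompletion ℚ] (w.adicCompletion L₃), σ ≠ 1 :=
  ⟨finrank_eq_two w, 3, π w, irreducible_three, irreducible_pi w, not_irreducible_algebraMap_three w, isUnit_two,
    exists_algEquiv_ne_one w⟩

end Summit.Ventures.HodgeRepro2.T5EisensteinPlace
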